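import Summits.ValiantsHypothesis.ValiantsHypothesis.Theorems.TwoAdicLadderTwoIntegralNormalisationScaledHalfElim
import Summits.ValiantsHypothesis.ValiantsHypothesis.Theorems.TwoAdicLadderTwoIntegralNormalisationClosure
import Summits.ValiantsHypothesis.ValiantsHypothesis.Theorems.TwoAdicLadderAssembly

/-!
# TwoAdicLadder — crux `TwoIntegralNormalisation` (stmt-ValiantsHypothesis-5947), line `birth`,
# stub `stub_halfElim`: THE EXACT-DIVISION FORM (the `2`-adic height of constants is irrelevant)

Route `ValiantsHypothesis/TwoAdicLadder`, crux `TwoIntegralNormalisation` (TIN), registered line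
`Cruxes/TwoIntegralNormalisation/Lines/birth.lean`, load-bearing OPEN stub `stub_halfElim`
(uniform elimination of division by `2` for the permanent). The previous census
(`…HalfElimKernel.lean`, `halfElim_of_scaledPoly_of_polyDivision`) split the stub into TWO open
pieces: a polynomial bound on the clearing exponent `M` ("`PolyHeightCircuits`", the `2`-adic
height of the constants of near-optimal circuits) AND exact division by `2^M` at cost polynomial
in `s + M + n`. This file shows that the first piece is spurious: in Valiant's model constants are
free, so the size of `M` never enters, and the stub is EQUIVALENT to a single exact-division
statement whose cost bound does not mention `M` at all.

* `complexity_map_le_complexity_C_two_pow_mul_succ` — over the number field `K` one division by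
  `2^M` is one gate: `L_K(f) ≤ L_{𝓞_(𝔭)}(2^M · f) + 1`.
* `numberFieldEasy_iff_scaledTwoIntegralEasy` — **unconditionally**, "`per` has polynomial-size
  circuits over number fields" `⟺` "the SCALED permanents `2^{M_n} · per_n` (some `M_n : ℕ`) have
  polynomial-size circuits over local rings `𝓞_(𝔭)`, `𝔭 ∋ 2`, of number fields"
  (`→` is the landed `scaledHalfElim`, `←` is the previous bullet);
  `VP_eq_VNP_complex_iff_scaledTwoIntegralEasy` — hence `VP_ℂ = VNP_ℂ` `⟺` the latter.
* `halfElim_iff_divElim` — **the registered signature of `stub_halfElim` is EQUIVALENT to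
  `DivElim`**: one exponent `d` such that `L_{𝓞_(𝔭)}(2^M · per_n) ≤ s` (any `M`, any number field,
  any `𝔭 ∋ 2`) gives `L_{𝓞_(𝔭')}(per_n) ≤ (s + n + 2)^d` over some `𝓞_(𝔭')`, `𝔭' ∋ 2`, of some
  number field — exact division by an arbitrary power of `2` at cost polynomial in `s` and `n`
  ONLY. No height hypothesis survives.
* `divElimGlobal_iff_halfElimGlobal`, `twoIntegralNormalisation_of_divElimGlobal` — the same for
  the VH-implied global form: **TIN ⟸ DivElimGlobal** ("if the scaled permanents are `2`-integrally
  p-computable then the permanents are, eventually"), and `divElimGlobal_of_valiantsHypothesis`.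
* `halfElimGlobal_iff_valiantsHypothesis_of_precisionLadder` — calibration: granted the route's
  other crux `PrecisionLadder` (itself VH-implied, `ladderOfVH_proof`), the global form is
  EQUIVALENT to VP ≠ VNP (assembly one way, vacuity the other).

Net census change: the open kernel of `stub_halfElim` is exactly ONE statement, `DivElim` (exact
division of the permanent by a power of `2` over a `2`-adically integral number ring, cost
independent of the exponent); its first test case is a single halving (`M = 1`).
Honest framing: `stub_halfElim`, `DivElim`, the crux and VP ≠ VNP are NOT proved here.
-/

noncomputable section

open MvPolynomial

-- the summit and the problem share the name `ValiantsHypothesis` (D-0017 single-conjunct layout)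
set_option linter.dupNamespace false

namespace Summit.ValiantsHypothesis.ValiantsHypothesis.Theorems.TwoAdicLadder.TwoIntegralNormalisation

open Summit.ValiantsHypothesis.ValiantsHypothesis.Theses.TwoAdicLadder
open NumberField Literature.Computability.AlgebraicComplexity

/-! ### One division by `2^M` over the field costs one gate -/

/-- **Over the number field, undoing the scaling is one gate.** For a number field `K`, a prime
`𝔭 ∋ 2` of `𝓞 K` and the (injective) inclusion `ι : 𝓞_(𝔭) → K`: for every `f` over `𝓞_(𝔭)` and
every `M`, `L_K(ι f) ≤ L_{𝓞_(𝔭)}(2^M · f) + 1` — transport the `𝓞_(𝔭)`-circuit along `ι`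
(extension of scalars is free, `complexity_map_le`) and multiply by the constant `2^{-M} ∈ K`
(`complexity_smul_le`). [folklore; Burgisser2000 §4.1] -/
theorem complexity_map_le_complexity_C_two_pow_mul_succ {σ : Type*} (K : Type) [Field K]
    [NumberField K] (P : Ideal (𝓞 K)) [P.IsPrime] (h2 : (2 : 𝓞 K) ∈ P) :
    ∃ ι : Localization.AtPrime P →+* K, Function.Injective ι ∧
      ∀ (M : ℕ) (f : MvPolynomial σ (Localization.AtPrime P)),
        complexity (MvPolynomial.map ι f) ≤
          complexity (C ((2 : Localization.AtPrime P) ^ M) * f) + 1 := by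
  obtain ⟨ι, hι, -⟩ := exists_ringHom_localizationAtPrime_two K P h2
  refine ⟨ι, hι, fun M f => ?_⟩
  have h2K : ((2 : K) ^ M) ≠ 0 := pow_ne_zero M two_ne_zero
  -- `ι f = 2^{-M} • ι (2^M · f)`
  have key : MvPolynomial.map ι f =
      ((2 : K) ^ M)⁻¹ • MvPolynomial.map ι (C ((2 : Localization.AtPrime P) ^ M) * f) := by
    rw [map_mul, map_C, map_pow, map_ofNat, MvPolynomial.C_mul', smul_smul,
      inv_mul_cancel₀ h2K, one_smul]
  rw [key]
  refine (complexity_smul_le_holds _ _).trans ?_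
  exact Nat.add_le_add_right (ArithCircuit.complexity_map_le ι _) 1

/-- The permanent instance: `L_K(per_n) ≤ L_{𝓞_(𝔭)}(2^M · per_n) + 1` for every `M`, every
number field `K` and every prime `𝔭 ∋ 2` of `𝓞 K`. [folklore] -/
theorem complexity_perPoly_le_complexity_C_two_pow_mul_succ (n M : ℕ) (K : Type) [Field K]
    [NumberField K] (P : Ideal (𝓞 K)) [P.IsPrime] (h2 : (2 : 𝓞 K) ∈ P) :
    complexity (perPoly (Fin n) K) ≤
      complexity (C ((2 : Localization.AtPrime P) ^ M) *
        perPoly (Fin n) (Localization.AtPrime P)) + 1 := by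
  obtain ⟨ι, -, hι⟩ := complexity_map_le_complexity_C_two_pow_mul_succ
    (σ := Fin n × Fin n) K P h2
  have h := hι M (perPoly (Fin n) (Localization.AtPrime P))
  rwa [map_perPoly] at h

/-! ### The hypothesis of the crux in `2`-integral currency (unconditional equivalences) -/

/-- Envelope bookkeeping: `n^a + a + 1 ≤ n^(a+2) + (a+2)` for all `n, a`. [folklore] -/
theorem pow_add_add_one_le (n a : ℕ) : n ^ a + a + 1 ≤ n ^ (a + 2) + (a + 2) := by
  rcases Nat.eq_zero_or_pos n with rfl | hn
  · rcases Nat.eq_zero_or_pos a with rfl | ha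
    · simp
    · rw [zero_pow ha.ne', zero_pow (by omega)]; omega
  · have : n ^ a ≤ n ^ (a + 2) := Nat.pow_le_pow_right hn (by omega)
    omega

/-- **Number-field easiness of `per` `⟺` `2`-integral easiness of the SCALED permanents**
(unconditional). The permanent family has polynomial-size circuits over number fields (one
exponent, every `n`, the number field depending on `n`) iff for one exponent and every `n` some
scaled permanent `2^M · per_n` (`M` depending on `n`, unbounded, its size irrelevant: constants are
free) has polynomial-size circuits over the local ring `𝓞_(𝔭)` at some prime `𝔭 ∋ 2` of some
number field. `→`: denominator clearing (`scaledHalfElim`); `←`: one division by `2^M` over `K`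
(`complexity_perPoly_le_complexity_C_two_pow_mul_succ`). [folklore; Burgisser2000 §4.1, §4.3] -/
theorem numberFieldEasy_iff_scaledTwoIntegralEasy :
    (∃ a : ℕ, ∀ n : ℕ, ∃ (K : Type) (_ : Field K) (_ : NumberField K),
        complexity (perPoly (Fin n) K) ≤ n ^ a + a) ↔
    (∃ a : ℕ, ∀ n : ℕ, ∃ (K : Type) (_ : Field K) (_ : NumberField K)
        (P : Ideal (𝓞 K)) (_ : P.IsPrime), (2 : 𝓞 K) ∈ P ∧ ∃ M : ℕ,
        complexity (C ((2 : Localization.AtPrime P) ^ M) *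
          perPoly (Fin n) (Localization.AtPrime P)) ≤ n ^ a + a) := by
  constructor
  · rintro ⟨a, ha⟩
    refine ⟨a, fun n => ?_⟩
    obtain ⟨K, hF, hN, hK⟩ := ha n
    obtain ⟨K', hF', hN', P, hP, h2, M, hM⟩ := @scaledHalfElim n (n ^ a + a) K hF hN hK
    exact ⟨K', hF', hN', P, hP, h2, M, hM⟩
  · rintro ⟨a, ha⟩
    refine ⟨a + 2, fun n => ?_⟩
    obtain ⟨K, hF, hN, P, hP, h2, M, hM⟩ := ha n
    refine ⟨K, hF, hN, ?_⟩
    have h := @complexity_perPoly_le_complexity_C_two_pow_mul_succ n M K hF hN P hP h2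
    exact (h.trans (Nat.add_le_add_right hM 1)).trans (pow_add_add_one_le n a)

/-- **`per` is p-computable over `ℂ` `⟺` the scaled permanents are `2`-integrally p-computable
over number rings** (unconditional): `→` via algebraic constants (landed `stub_algConst`) and
denominator clearing, `←` via one division over the number field and an embedding into `ℂ`
(`isPComputable_perPoly_complex_of_numberField`). [folklore; Burgisser2000 §4.1, §4.3] -/
theorem isPComputable_complex_iff_scaledTwoIntegralEasy :
    IsPComputable (fun n => perPoly (Fin n) ℂ) ↔
    (∃ a : ℕ, ∀ n : ℕ, ∃ (K : Type) (_ : Field K) (_ : NumberField K)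
        (P : Ideal (𝓞 K)) (_ : P.IsPrime), (2 : 𝓞 K) ∈ P ∧ ∃ M : ℕ,
        complexity (C ((2 : Localization.AtPrime P) ^ M) *
          perPoly (Fin n) (Localization.AtPrime P)) ≤ n ^ a + a) := by
  constructor
  · intro h
    exact numberFieldEasy_iff_scaledTwoIntegralEasy.1 (stub_algConst h)
  · intro h
    exact isPComputable_perPoly_complex_of_numberField
      (numberFieldEasy_iff_scaledTwoIntegralEasy.2 h)

/-- **`VP_ℂ = VNP_ℂ` `⟺` the scaled permanents `2^{M_n} · per_n` have polynomial-size
`2`-adically integral circuits over number rings** (unconditional; the negation of the summit in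
`2`-integral currency). [folklore; Burgisser2000 Rem. 2.11, §4.1, §4.3] -/
theorem VP_eq_VNP_complex_iff_scaledTwoIntegralEasy :
    VP ℂ = VNP ℂ ↔
    (∃ a : ℕ, ∀ n : ℕ, ∃ (K : Type) (_ : Field K) (_ : NumberField K)
        (P : Ideal (𝓞 K)) (_ : P.IsPrime), (2 : 𝓞 K) ∈ P ∧ ∃ M : ℕ,
        complexity (C ((2 : Localization.AtPrime P) ^ M) *
          perPoly (Fin n) (Localization.AtPrime P)) ≤ n ^ a + a) :=
  isPComputable_perPoly_complex_iff.symm.trans isPComputable_complex_iff_scaledTwoIntegralEasy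

/-! ### The registered stub is exactly exact division by a power of `2` -/

/-- Envelope bookkeeping: `(s + 1 + n + 2)^d ≤ (s + n + 2)^(2d)`. [folklore] -/
theorem succ_envelope (s n d : ℕ) : (s + 1 + n + 2) ^ d ≤ (s + n + 2) ^ (2 * d) := by
  have h : s + 1 + n + 2 ≤ (s + n + 2) ^ 2 := by nlinarith
  calc (s + 1 + n + 2) ^ d ≤ ((s + n + 2) ^ 2) ^ d := Nat.pow_le_pow_left h d
    _ = (s + n + 2) ^ (2 * d) := (pow_mul (s + n + 2) 2 d).symm

/-- **`stub_halfElim ⟺ DivElim`.** The registered signature of `stub_halfElim` (right-hand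
side, verbatim: uniform `1/2`-elimination for the permanent from number-field circuits) is
equivalent to **`DivElim`** (left-hand side): one exponent `d` such that for all `n s M`, every
number field `K` and every prime `𝔭 ∋ 2` of `𝓞 K`, a circuit of size `≤ s` for `2^M · per_n`
over `𝓞_(𝔭)` yields a circuit of size `≤ (s + n + 2)^d` for `per_n` itself over the local ring
`𝓞_(𝔭')` at some prime `𝔭' ∋ 2` of some number field. The cost bound of `DivElim` does not mention
`M`: the `2`-adic height of the constants (the size of the clearing exponent) plays no role, so the
earlier two-piece kernel `ScaledHalfElimPoly ∧ PolyDivision` (`halfElim_of_scaledPoly_of_polyDivision`)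
collapses to this single piece. `→`: clear denominators for free (`scaledHalfElim`) and divide;
`←`: undo the scaling over `K` at the cost of one gate and apply the stub (exponent `2d`).
[folklore] -/
theorem halfElim_iff_divElim :
    (∃ d : ℕ, ∀ (n s M : ℕ) (K : Type) [Field K] [NumberField K] (P : Ideal (𝓞 K)) [P.IsPrime],
      (2 : 𝓞 K) ∈ P →
        complexity (C ((2 : Localization.AtPrime P) ^ M) *
          perPoly (Fin n) (Localization.AtPrime P)) ≤ s →
        ∃ (K' : Type) (_ : Field K') (_ : NumberField K')
          (P' : Ideal (𝓞 K')) (_ : P'.IsPrime), (2 : 𝓞 K') ∈ P' ∧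
          complexity (perPoly (Fin n) (Localization.AtPrime P')) ≤ (s + n + 2) ^ d) ↔
    (∃ d : ℕ, ∀ (n s : ℕ) (K : Type) [Field K] [NumberField K],
      complexity (perPoly (Fin n) K) ≤ s →
        ∃ (K' : Type) (_ : Field K') (_ : NumberField K')
          (P : Ideal (𝓞 K')) (_ : P.IsPrime), (2 : 𝓞 K') ∈ P ∧
          complexity (perPoly (Fin n) (Localization.AtPrime P)) ≤ (s + n + 2) ^ d) := by
  constructor
  · rintro ⟨d, hd⟩
    refine ⟨d, fun n s K _ _ hs => ?_⟩
    obtain ⟨K₁, hF₁, hN₁, P₁, hP₁, h2₁, M, hM⟩ := scaledHalfElim n s K hs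
    exact @hd n s M K₁ hF₁ hN₁ P₁ hP₁ h2₁ hM
  · rintro ⟨d, hd⟩
    refine ⟨2 * d, fun n s M K _ _ P _ h2 hs => ?_⟩
    have hK : complexity (perPoly (Fin n) K) ≤ s + 1 :=
      (complexity_perPoly_le_complexity_C_two_pow_mul_succ n M K P h2).trans
        (Nat.add_le_add_right hs 1)
    obtain ⟨K', hF', hN', P', hP', h2', hle⟩ := hd n (s + 1) K hK
    exact ⟨K', hF', hN', P', hP', h2', hle.trans (succ_envelope s n d)⟩

/-- **`DivElim` closes the crux** (with the landed stubs): the exact-division form implies the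
registered stub (`halfElim_iff_divElim`), which implies `TwoIntegralNormalisation`
(`twoIntegralNormalisation_of_halfElim'`). [folklore] -/
theorem twoIntegralNormalisation_of_divElim
    (h : ∃ d : ℕ, ∀ (n s M : ℕ) (K : Type) [Field K] [NumberField K] (P : Ideal (𝓞 K))
      [P.IsPrime], (2 : 𝓞 K) ∈ P →
        complexity (C ((2 : Localization.AtPrime P) ^ M) *
          perPoly (Fin n) (Localization.AtPrime P)) ≤ s →
        ∃ (K' : Type) (_ : Field K') (_ : NumberField K')
          (P' : Ideal (𝓞 K')) (_ : P'.IsPrime), (2 : 𝓞 K') ∈ P' ∧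
          complexity (perPoly (Fin n) (Localization.AtPrime P')) ≤ (s + n + 2) ^ d) :
    TwoIntegralNormalisation :=
  twoIntegralNormalisation_of_halfElim' (halfElim_iff_divElim.1 h)

/-! ### The global (VH-implied) form in exact-division currency -/

/-- **`DivElimGlobal ⟺ HalfElimGlobal`.** The global form of exact division ("if for one
exponent and every `n` some scaled permanent `2^M · per_n` has polynomial-size circuits over some
`𝓞_(𝔭)`, `𝔭 ∋ 2`, then for all large `n` the permanent `per_n` itself does") is equivalent to the
global form of `1/2`-elimination `HalfElimGlobal` of `…OfHalfElim.lean` (same conclusion; the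
hypotheses agree by `numberFieldEasy_iff_scaledTwoIntegralEasy`). [folklore] -/
theorem divElimGlobal_iff_halfElimGlobal :
    ((∃ a : ℕ, ∀ n : ℕ, ∃ (K : Type) (_ : Field K) (_ : NumberField K)
        (P : Ideal (𝓞 K)) (_ : P.IsPrime), (2 : 𝓞 K) ∈ P ∧ ∃ M : ℕ,
        complexity (C ((2 : Localization.AtPrime P) ^ M) *
          perPoly (Fin n) (Localization.AtPrime P)) ≤ n ^ a + a) →
      ∃ b : ℕ, ∀ᶠ n in Filter.atTop, ∃ (K' : Type) (_ : Field K') (_ : NumberField K')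
        (P : Ideal (𝓞 K')) (_ : P.IsPrime), (2 : 𝓞 K') ∈ P ∧
        complexity (perPoly (Fin n) (Localization.AtPrime P)) ≤ n ^ b) ↔
    ((∃ a : ℕ, ∀ n : ℕ, ∃ (K : Type) (_ : Field K) (_ : NumberField K),
        complexity (perPoly (Fin n) K) ≤ n ^ a + a) →
      ∃ b : ℕ, ∀ᶠ n in Filter.atTop, ∃ (K' : Type) (_ : Field K') (_ : NumberField K')
        (P : Ideal (𝓞 K')) (_ : P.IsPrime), (2 : 𝓞 K') ∈ P ∧
        complexity (perPoly (Fin n) (Localization.AtPrime P)) ≤ n ^ b) :=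
  Iff.intro (fun h hK => h (numberFieldEasy_iff_scaledTwoIntegralEasy.1 hK))
    (fun h hS => h (numberFieldEasy_iff_scaledTwoIntegralEasy.2 hS))

/-- **`DivElimGlobal → TwoIntegralNormalisation`** (landed stubs plugged in through
`twoIntegralNormalisation_of_halfElimGlobal'`): the crux is reduced, unconditionally, to the
global exact-division statement for the permanent over `2`-adically integral number rings.
[folklore] -/
theorem twoIntegralNormalisation_of_divElimGlobal
    (h : (∃ a : ℕ, ∀ n : ℕ, ∃ (K : Type) (_ : Field K) (_ : NumberField K)
        (P : Ideal (𝓞 K)) (_ : P.IsPrime), (2 : 𝓞 K) ∈ P ∧ ∃ M : ℕ,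
        complexity (C ((2 : Localization.AtPrime P) ^ M) *
          perPoly (Fin n) (Localization.AtPrime P)) ≤ n ^ a + a) →
      ∃ b : ℕ, ∀ᶠ n in Filter.atTop, ∃ (K' : Type) (_ : Field K') (_ : NumberField K')
        (P : Ideal (𝓞 K')) (_ : P.IsPrime), (2 : 𝓞 K') ∈ P ∧
        complexity (perPoly (Fin n) (Localization.AtPrime P)) ≤ n ^ b) :
    TwoIntegralNormalisation :=
  twoIntegralNormalisation_of_halfElimGlobal' (divElimGlobal_iff_halfElimGlobal.1 h)

/-- **`DivElim` (uniform) implies `DivElimGlobal`** (through the registered stub and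
`halfElimGlobal_of_halfElim`). [folklore] -/
theorem divElimGlobal_of_divElim
    (h : ∃ d : ℕ, ∀ (n s M : ℕ) (K : Type) [Field K] [NumberField K] (P : Ideal (𝓞 K))
      [P.IsPrime], (2 : 𝓞 K) ∈ P →
        complexity (C ((2 : Localization.AtPrime P) ^ M) *
          perPoly (Fin n) (Localization.AtPrime P)) ≤ s →
        ∃ (K' : Type) (_ : Field K') (_ : NumberField K')
          (P' : Ideal (𝓞 K')) (_ : P'.IsPrime), (2 : 𝓞 K') ∈ P' ∧
          complexity (perPoly (Fin n) (Localization.AtPrime P')) ≤ (s + n + 2) ^ d) :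
    (∃ a : ℕ, ∀ n : ℕ, ∃ (K : Type) (_ : Field K) (_ : NumberField K)
        (P : Ideal (𝓞 K)) (_ : P.IsPrime), (2 : 𝓞 K) ∈ P ∧ ∃ M : ℕ,
        complexity (C ((2 : Localization.AtPrime P) ^ M) *
          perPoly (Fin n) (Localization.AtPrime P)) ≤ n ^ a + a) →
      ∃ b : ℕ, ∀ᶠ n in Filter.atTop, ∃ (K' : Type) (_ : Field K') (_ : NumberField K')
        (P : Ideal (𝓞 K')) (_ : P.IsPrime), (2 : 𝓞 K') ∈ P ∧
        complexity (perPoly (Fin n) (Localization.AtPrime P)) ≤ n ^ b :=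
  divElimGlobal_iff_halfElimGlobal.2 (halfElimGlobal_of_halfElim (halfElim_iff_divElim.1 h))

/-- **`DivElimGlobal` is implied by VP ≠ VNP** (it cannot fail unless the summit does): under the
summit its hypothesis is void (`VP_eq_VNP_complex_iff_scaledTwoIntegralEasy`). [folklore] -/
theorem divElimGlobal_of_valiantsHypothesis (hVH : _root_.ValiantsHypothesis) :
    (∃ a : ℕ, ∀ n : ℕ, ∃ (K : Type) (_ : Field K) (_ : NumberField K)
        (P : Ideal (𝓞 K)) (_ : P.IsPrime), (2 : 𝓞 K) ∈ P ∧ ∃ M : ℕ,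
        complexity (C ((2 : Localization.AtPrime P) ^ M) *
          perPoly (Fin n) (Localization.AtPrime P)) ≤ n ^ a + a) →
      ∃ b : ℕ, ∀ᶠ n in Filter.atTop, ∃ (K' : Type) (_ : Field K') (_ : NumberField K')
        (P : Ideal (𝓞 K')) (_ : P.IsPrime), (2 : 𝓞 K') ∈ P ∧
        complexity (perPoly (Fin n) (Localization.AtPrime P)) ≤ n ^ b :=
  divElimGlobal_iff_halfElimGlobal.2 (halfElimGlobal_of_valiantsHypothesis hVH)

/-! ### Calibration: granted `PrecisionLadder`, the global form is the summit -/

/-- **Granted the route's other crux `PrecisionLadder`, `HalfElimGlobal ⟺ VP ≠ VNP`**: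
`→` by the route's assembly (`assembly_proof : PrecisionLadder → TwoIntegralNormalisation → VH`
with `twoIntegralNormalisation_of_halfElimGlobal'`), `←` by vacuity
(`halfElimGlobal_of_valiantsHypothesis`). Since `PrecisionLadder` is itself VH-implied
(`ladderOfVH_proof`), the reshaped line loses nothing and gains nothing in strength relative to
the summit: its content is the METHOD (exact division by powers of `2`). [folklore] -/
theorem halfElimGlobal_iff_valiantsHypothesis_of_precisionLadder (hPL : PrecisionLadder) :
    ((∃ a : ℕ, ∀ n : ℕ, ∃ (K : Type) (_ : Field K) (_ : NumberField K),
        complexity (perPoly (Fin n) K) ≤ n ^ a + a) →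
      ∃ b : ℕ, ∀ᶠ n in Filter.atTop, ∃ (K' : Type) (_ : Field K') (_ : NumberField K')
        (P : Ideal (𝓞 K')) (_ : P.IsPrime), (2 : 𝓞 K') ∈ P ∧
        complexity (perPoly (Fin n) (Localization.AtPrime P)) ≤ n ^ b) ↔
    _root_.ValiantsHypothesis :=
  Iff.intro (fun h => assembly_proof hPL (twoIntegralNormalisation_of_halfElimGlobal' h))
    halfElimGlobal_of_valiantsHypothesis

/-- The same calibration in exact-division currency: granted `PrecisionLadder`,
`DivElimGlobal ⟺ VP ≠ VNP`. [folklore] -/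
theorem divElimGlobal_iff_valiantsHypothesis_of_precisionLadder (hPL : PrecisionLadder) :
    ((∃ a : ℕ, ∀ n : ℕ, ∃ (K : Type) (_ : Field K) (_ : NumberField K)
        (P : Ideal (𝓞 K)) (_ : P.IsPrime), (2 : 𝓞 K) ∈ P ∧ ∃ M : ℕ,
        complexity (C ((2 : Localization.AtPrime P) ^ M) *
          perPoly (Fin n) (Localization.AtPrime P)) ≤ n ^ a + a) →
      ∃ b : ℕ, ∀ᶠ n in Filter.atTop, ∃ (K' : Type) (_ : Field K') (_ : NumberField K')
        (P : Ideal (𝓞 K')) (_ : P.IsPrime), (2 : 𝓞 K') ∈ P ∧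
        complexity (perPoly (Fin n) (Localization.AtPrime P)) ≤ n ^ b) ↔
    _root_.ValiantsHypothesis :=
  divElimGlobal_iff_halfElimGlobal.trans (halfElimGlobal_iff_valiantsHypothesis_of_precisionLadder hPL)

end Summit.ValiantsHypothesis.ValiantsHypothesis.Theorems.TwoAdicLadder.TwoIntegralNormalisation

end
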